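/-
Copyright (c) 2026. All rights reserved.
Released under Apache 2.0 license as described in the file LICENSE.
Authors: abc-iut cell — seat abc-iut-w6-d024 (gen 4; block C / W6, L4-lead RULING #7o row «COR27e-TYPE»):
PROOF-ONLY companion of `ArchimedeanReconstructionCor27eGermAutFromAutHol.lean` (this seat, p437330).
-/
import Literature.AnabelianGeometry.AbsoluteAnabelian.ArchimedeanReconstructionCor27eAutHolDiscOrbits
import Literature.AnabelianGeometry.AbsoluteAnabelian.ArchimedeanReconstructionCor27eGermAutFromAutHol
import HarnessLib

/-!
# [AbsTopIII] Cor 2.7 (e) at the germ model: `germAutFromAutHol V p = germAut p` — PROOF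

S. Mochizuki, *Topics in absolute anabelian geometry III* (bib key `MochizukiAbsTopIII2015`), Cor 2.7 (e)
(kurims p.60 l.2–14).  PROOF-ONLY file (no definitions): the named fact `Cor27eGermAutFromAutHol` of the
statement file `ArchimedeanReconstructionCor27eGermAutFromAutHol.lean` HOLDS — for every planar
Aut-holomorphic disc `V` and `p ∈ V`, the group of germ automorphisms at `p` cut out by the local additive
structure, the orientations, and the orthogonal frames OF Cor 2.7 (d) (read off `𝒜_𝕍(V^top) = Aut^hol(V)`
alone) coincides with the group `𝒜_p = germAut p` of Prop 2.6 (a) (Euclidean orthogonal frames).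

Steps: the frames of (d) (`autHolOrthFramesAt V p`) are orthogonal (abc-iut-w4-d104 / L4-t7
`inner_eq_zero_of_tangent_conj_oneParameterSubgroup`); in a frame one leg vanishes iff the other does
(conjugate velocity `= ±i ·` velocity, `Cor27e.deriv_conj_orbit_eq`); and — the EXISTENCE half — every
pair of non-zero orthogonal vectors at `p` is a frame of (d) (`Cor27e.exists_oneParameterSubgroup_hasDerivAt`,
`Cor27e.exists_orderFour_stabilizer`).  Hence "preserves the frames of (d)" ⟺ "preserves Euclidean
orthogonality" for affine germs, and the two groups coincide (`mem_germAut_iff`, `compat_mulGerm`).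

HONEST SCOPE as in the statement file: MODEL LEVEL (planar Aut-holomorphic disc).  Refereed pre-IUT
material; nothing here bears on the disputed [IUTchIII] Cor. 3.12; typed ≠ endorsed.
-/

noncomputable section

namespace Literature.AnabelianGeometry.AbsoluteAnabelian

open _root_.TopologicalSpace _root_.Topology _root_.Set _root_.Metric _root_.Function _root_.Filter
open scoped _root_.Manifold _root_.ContDiff ComplexConjugate UpperHalfPlane MatrixGroups InnerProductSpace
open _root_.UpperHalfPlane Literature.Analysis.Complex NormedSpace _root_.Complex
open scoped Matrix.Norms.Operator

set_option backward.isDefEq.respectTransparency false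

namespace Cor27e

variable (V : Opens ℂ)

/-! ### The frames of (d) are exactly the pairs of non-zero orthogonal vectors, plus `(0, 0)` -/

/-- Frames of (d) are orthogonal (abc-iut-w4-d104 / L4-t7, «tangent ⇒ orthogonal»).
[cite: MochizukiAbsTopIII2015, Corollary 2.7 (d) p.59] -/
theorem inner_eq_zero_of_mem_autHolOrthFramesAt (hV : IsAutHolDisc V) (p : V) {e : ℂ × ℂ}
    (he : e ∈ autHolOrthFramesAt V p) : ⟪e.1, e.2⟫_ℝ = 0 := by
  letI := homeoCompactOpen (⊤ : Opens V)
  obtain ⟨f, k, r₁, r₂, hf, hkp, hk4, hk2, -, -, he₁, he₂⟩ := he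
  exact inner_eq_zero_of_tangent_conj_oneParameterSubgroup V hV p f k hkp hk4 hk2 r₁ r₂ hf he₁ he₂

/-- In a frame of (d) one leg vanishes iff the other does (the conjugate orbit has velocity `±i` times
the velocity). [cite: MochizukiAbsTopIII2015, Corollary 2.7 (d) p.59] -/
theorem fst_eq_zero_iff_snd_eq_zero_of_mem (hV : IsAutHolDisc V) (p : V) {e : ℂ × ℂ}
    (he : e ∈ autHolOrthFramesAt V p) : e.1 = 0 ↔ e.2 = 0 := by
  letI := homeoCompactOpen (⊤ : Opens V)
  obtain ⟨f, k, r₁, r₂, hf, hkp, hk4, hk2, hr₁, hr₂, he₁, he₂⟩ := he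
  obtain ⟨hc, hconj⟩ := deriv_conj_orbit_eq V hV p f k hkp hk4 hk2 hf
  have hc0 : deriv (Function.extend Subtype.val (fun x : V => (((((k : holAut (⊤ : Opens V)) :
      (⊤ : Opens V) ≃ₜ (⊤ : Opens V)) ⟨x, trivial⟩ : (⊤ : Opens V)) : V) : ℂ)) (fun z => z)) p ≠ 0 := by
    rcases hc with h | h <;> rw [h] <;> simp
  have hr₁0 : (r₁ : ℂ) ≠ 0 := by exact_mod_cast hr₁.ne'
  have hr₂0 : (r₂ : ℂ) ≠ 0 := by exact_mod_cast hr₂.ne'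
  rw [he₁, he₂, hconj]
  constructor
  · intro h
    rcases mul_eq_zero.1 h with h | h
    · exact absurd h hr₁0
    · rw [h, mul_zero, mul_zero]
  · intro h
    rcases mul_eq_zero.1 h with h | h
    · exact absurd h hr₂0
    · rcases mul_eq_zero.1 h with h | h
      · exact absurd h hc0
      · rw [h, mul_zero]

/-- **Every pair of non-zero orthogonal vectors at `p` is a frame of (d)** (the converse inclusion of the
printed "In particular … one may construct the orthogonal frames … as the frames … tangent to orbits").
[cite: MochizukiAbsTopIII2015, Corollary 2.7 (d) p.59] -/
theorem mem_autHolOrthFramesAt_of_inner_eq_zero (hV : IsAutHolDisc V) (p : V) {a b : ℂ} (ha : a ≠ 0)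
    (hb : b ≠ 0) (hab : ⟪a, b⟫_ℝ = 0) : (a, b) ∈ autHolOrthFramesAt V p := by
  letI := homeoCompactOpen (⊤ : Opens V)
  obtain ⟨t, ht⟩ := exists_eq_smul_I_mul_of_inner_eq_zero ha hab
  have ht0 : t ≠ 0 := by
    rintro rfl; apply hb; rw [ht]; simp
  obtain ⟨f, hf, hder⟩ := exists_oneParameterSubgroup_hasDerivAt V hV p a
  have hderiv := hder.deriv
  obtain ⟨k, hkp, hk4, hk2⟩ := exists_orderFour_stabilizer V hV p
  -- `k⁻¹` is also of order four and fixes `p`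
  have hkp' : ((k⁻¹ : holAut (⊤ : Opens V)) : (⊤ : Opens V) ≃ₜ (⊤ : Opens V)) ⟨p, trivial⟩ = ⟨p, trivial⟩ := by
    have h := congrArg ((k⁻¹ : holAut (⊤ : Opens V)) : (⊤ : Opens V) ≃ₜ (⊤ : Opens V)) hkp
    rw [← Homeomorph.mul_apply, ← Subgroup.coe_mul, inv_mul_cancel, Subgroup.coe_one,
      Homeomorph.one_apply] at h
    exact h.symm
  have hk4' : k⁻¹ * k⁻¹ * k⁻¹ * k⁻¹ = 1 := by
    have h := congrArg (fun x => x⁻¹) hk4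
    simpa only [mul_inv_rev, inv_one, mul_assoc] using h
  have hk2' : k⁻¹ * k⁻¹ ≠ 1 := by
    intro h
    apply hk2
    have h' := congrArg (fun x => x⁻¹) h
    simpa only [mul_inv_rev, inv_inv, inv_one] using h'
  obtain ⟨hc, hconj⟩ := deriv_conj_orbit_eq V hV p f k hkp hk4 hk2 hf
  obtain ⟨hc', hconj'⟩ := deriv_conj_orbit_eq V hV p f k⁻¹ hkp' hk4' hk2' hf
  have hprod := deriv_planar_inv_mul_deriv_planar V k p hkp
  rw [hderiv] at hconj hconj'
  have ha1 : a = ((1 : ℝ) : ℂ) * deriv (fun t : ℝ =>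
      (((((f (Multiplicative.ofAdd t) : holAut (⊤ : Opens V)) : (⊤ : Opens V) ≃ₜ (⊤ : Opens V))
        ⟨p, trivial⟩ : (⊤ : Opens V)) : V) : ℂ)) 0 := by
    rw [hderiv, ofReal_one, one_mul]
  rcases hc with h | h <;> rcases hc' with h' | h'
  · exfalso; rw [h, h'] at hprod; norm_num at hprod
  · -- `k` rotates by `i`, `k⁻¹` by `-i`
    rw [h] at hconj; rw [h'] at hconj'
    rcases lt_or_gt_of_ne ht0 with hneg | hpos
    · refine ⟨f, k⁻¹, 1, -t, hf, hkp', hk4', hk2', one_pos, by linarith, ha1, ?_⟩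
      rw [hconj', ht]; push_cast; ring
    · refine ⟨f, k, 1, t, hf, hkp, hk4, hk2, one_pos, hpos, ha1, ?_⟩
      rw [hconj, ht]
  · -- `k` rotates by `-i`, `k⁻¹` by `i`
    rw [h] at hconj; rw [h'] at hconj'
    rcases lt_or_gt_of_ne ht0 with hneg | hpos
    · refine ⟨f, k, 1, -t, hf, hkp, hk4, hk2, one_pos, by linarith, ha1, ?_⟩
      rw [hconj, ht]; push_cast; ring
    · refine ⟨f, k⁻¹, 1, t, hf, hkp', hk4', hk2', one_pos, hpos, ha1, ?_⟩
      rw [hconj', ht]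
  · exfalso; rw [h, h'] at hprod; norm_num at hprod

/-- Frames of (d) are stable under multiplication by a non-zero complex number.
[cite: MochizukiAbsTopIII2015, Corollary 2.7 (e) p.60] -/
theorem mul_mem_autHolOrthFramesAt (hV : IsAutHolDisc V) (p : V) {c : ℂ} (hc : c ≠ 0) {e : ℂ × ℂ}
    (he : e ∈ autHolOrthFramesAt V p) : (c * e.1, c * e.2) ∈ autHolOrthFramesAt V p := by
  by_cases h1 : e.1 = 0
  · have h2 : e.2 = 0 := (fst_eq_zero_iff_snd_eq_zero_of_mem V hV p he).1 h1
    have : (c * e.1, c * e.2) = e := by ext <;> simp [h1, h2]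
    rw [this]; exact he
  · have h2 : e.2 ≠ 0 := fun h => h1 ((fst_eq_zero_iff_snd_eq_zero_of_mem V hV p he).2 h)
    refine mem_autHolOrthFramesAt_of_inner_eq_zero V hV p (mul_ne_zero hc h1) (mul_ne_zero hc h2) ?_
    rw [inner_mul_left_mul_left, inner_eq_zero_of_mem_autHolOrthFramesAt V hV p he, mul_zero]

end Cor27e

/-! ### The theorem -/

open Cor27e LocGerm in
/-- **[AbsTopIII] Cor 2.7 (e) at the germ model, PROVED**: for every planar Aut-holomorphic disc `V` and
`p ∈ V`, the germ automorphisms at `p` compatible with the local additive structure, preserving the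
orientations, and preserving the orthogonal frames OF (d) — read off `𝒜_𝕍(V^top) = Aut^hol(V)` alone —
are exactly `𝒜_p = germAut p` ("just as in Proposition 2.6, (a), we obtain …").
[cite: MochizukiAbsTopIII2015, Corollary 2.7 (e) p.60] -/
theorem cor27eGermAutFromAutHol_holds : Cor27eGermAutFromAutHol := by
  intro V hV p
  ext u
  constructor
  · rintro ⟨hadd, hor, L, hL, hmaps⟩
    refine (mem_germAut u).2 ⟨hadd, ⟨L, hL, fun x y hxy => ?_⟩, hor⟩
    by_cases hx : x = 0
    · rw [hx, map_zero, inner_zero_left]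
    by_cases hy : y = 0
    · rw [hy, map_zero, inner_zero_right]
    have hmem := hmaps (mem_autHolOrthFramesAt_of_inner_eq_zero V hV p hx hy hxy)
    exact inner_eq_zero_of_mem_autHolOrthFramesAt V hV p hmem
  · intro hu
    obtain ⟨c, rfl⟩ := (mem_germAut_iff u).1 hu
    obtain ⟨hadd, -, hor⟩ := compat_mulGerm (p := (p : ℂ)) c.ne_zero
    refine ⟨hadd, hor, c • ContinuousLinearMap.id ℝ ℂ, mulGerm_eq_linGerm (c : ℂ), fun e he => ?_⟩
    have h := mul_mem_autHolOrthFramesAt V hV p c.ne_zero he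
    simpa [Prod.map, Units.smul_def, smul_eq_mul] using h

/-- `Cor27eGermAutFromAutHol` — `_holds` alias of `cor27eGermAutFromAutHol_holds` above under the fact's exact name (appended
2026-08-28, D-0026 bookkeeping: the proof term is the existing theorem of this file; no statement,
definition or attribute is edited; no new named fact; the ledger's debt table listed the fact
unproved). [cite: MochizukiAbsTopIII2015, Corollary 2.7 (e) p.60] -/
theorem _root_.Literature.AnabelianGeometry.AbsoluteAnabelian.Cor27eGermAutFromAutHol_holds :
    Cor27eGermAutFromAutHol :=
  _root_.Literature.AnabelianGeometry.AbsoluteAnabelian.cor27eGermAutFromAutHol_holds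

end Literature.AnabelianGeometry.AbsoluteAnabelian

end
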